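import Mathlib
import HarnessLib
import HarnessLib.Audit
import Summits.QuantumAdvantage.Statement
import Literature.Computability.Cryptography.ShorAssemblyLeavesProofs
import HarnessLib.Audit.Status.Attr

/-!
Route: Shor

CLOSED (exhausted) 2026-08-16T05:19:55Z by planner-rbadge-QuantumAdvantage-Shor-36c510fd-g3-0 — reason: exhausted — note: route-repair g3 (badge; one-shot) — CLOSE exhausted WITH RESULT (D-0027 §2.2(c): a standalone bridge whose provable content is fully banked is recorded as theorems, not kept as route inventory; payload: "if the route cannot be made to conform, retire it"). RESULT (all in Literature, axioms propext/C. The file is kept as the record of this route; refuted decls are indexed as negative knowledge (`ledger negatives`).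

# Route Shor — factoring hardness + Shor's theorem (explicit conditional bridge on FACT ∉ BPP)

It suffices to show X = "the bounded-divisor factoring language FACT = {⟨N,k⟩ : ∃ d, 1 < d ≤ k, d ∣
N} is not in
BPP" — the factoring-hardness conjecture, carried BY NAME as the route's single crux `ShorThesis`
(rank 0,
hypothesis-type, conjecture-grade; never staffed for proof: X ⟹ NP ⊄ BPP ⟹ the PneNP summit,
certified in-model by
the route review of 2026-08-15). The bridge half is Shor's theorem FACT ∈ BQP, which is a
PROVED Literature theorem (`Literature.Computability.Cryptography.FACT_mem_BQP_holds`, with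
`factoring_mem_FBQP_holds` and `P_subset_BQP_holds`; ShorAssemblyLeavesProofs.lean /
ClassBQPProofs.lean; axioms
propext / Classical.choice / Quot.sound) invoked INSIDE the deciding theorem:
`closes (hX : ShorThesis) : QuantumAdvantage := ⟨FACT, FACT_mem_BQP_holds, hX⟩` (crux-only, D-0027
§2.1).
So the route is a STANDALONE CONDITIONAL BRIDGE "QuantumAdvantage ⇐ FACT ∉ BPP" whose provable
content is
entirely earned; it realises no idea card (legacy survey route, 2026-08-13) and absorbed routes
AvgCase and
CircuitLB (closed superseded). It has exactly one uncertain node and therefore cannot meet the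
D-0019 two-crux
floor honestly; the floor waiver for declared bridges (`conditional_bridge`) is settable only at
`route open`.
Lean: `Literature.Computability.QuantumComplexity.FACT ∉ Literature.Computability.Complexity.BPP`

## Assembly
Pure logic against the existential statement `QuantumAdvantage := ∃ L, L ∈ BQP ∧ L ∉ BPP`: from hX :
ShorThesis
and the Literature theorem `FACT_mem_BQP_holds : FACT ∈ BQP`, `⟨FACT, FACT_mem_BQP_holds, hX⟩ :
QuantumAdvantage`.
This is the deciding theorem `closes` (crux-only; Sketch.lean rc 0, standard axioms, 2026-08-16).
The legacy items
ShorFactoringMemFBQP / ShorFBQPToFACT / ShorPSubsetBQP (PROVED in Literature), ShorSearchToDecision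
(vestigial, shared with
DarkClassGroups) and Assembly (legacy form over fact names, provable now) remain listed only because
item-set edits of an
under-floor route are refused; none is a hypothesis of `closes`.

UNDER FLOOR: fewer than 2 cruxes remain after retriage (legacy route; D-0019).

Rationale: WHY THIS LINE. This is the one line in print whose bridge to BQP ≠ BPP is a THEOREM (Shor1997 §5;
BernsteinVazirani1997
§8: BPP ⊆ BQP, so a hard BQP language IS the separation; AroraBarakCC2009 §10.6 "the strongest
evidence that BQP may
contain problems outside of BPP") and whose hypothesis is a standard LANGUAGE-level conjecture (not
a promise or sampling
assumption), so the deciding theorem has no typing gap: one line of logic against the D-0015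
existential statement.
Everything the tree could earn on this line — Shor's theorem in the TM-uniform exact Clifford+T
circuit-family model of
`Literature.Computability.Cryptography.BQP` (reversible compilation P ⊆ BQP, phase estimation /
order finding, continued
fractions, BQP^BQP = BQP subroutine composition, BV coins) — HAS BEEN EARNED in Literature:
`P_subset_BQP_holds`
(ClassBQPProofs), `factoring_mem_FBQP_holds`, `FACT_mem_BQP_holds` (ShorAssemblyLeavesProofs, via
BennettBernsteinBrassardVazirani1997 Cor. 4.15 and BernsteinVazirani1997 Thm 8.3), standard axioms.
Imported field:
computational number theory / quantum algorithms; no analogy. What remains is X itself, which no one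
attacks (X ⟹ NP ⊄
BPP; the 2026-08-15 route review certified ShorThesis → PneNP in-model): the route's standing value
is the
kernel-certified reduction "QuantumAdvantage ⇐ FACT ∉ BPP", the classical benchmark every
unconditional route of this
summit is measured against — a standalone bridge in the sense of D-0027 §2.2, not a staffable
thesis.

RANKED CRUXES. Exactly one uncertain node, so the D-0019 floor of two cannot be met honestly (no
second research
obstruction exists on this line; inventing one would be churn):
#0 ShorThesis (crux, hypothesis-type, conjecture-grade; auto-badged crux by the gate 2026-08-16 as
the underived
hypothesis of `closes`) — FACT ∉ BPP (Arora–Barak random-string form BPP = bp P). Not staffed for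
proof.
[difficulty: open-problem] (why it might fail: X may simply be false — FACT ∈ NP ∩ coNP ∩ BQP is not
NP-hard unless
NP = coNP, and FACT ∈ BPP, even FACT ∈ P, contradicts no other standard conjecture; only the absence
of algorithms
(GNFS L_N[1/3]) supports it; conversely X ⟹ NP ⊄ BPP, so no proof is expected.) [Shor1997,
AroraBarakCC2009 §10.6,
paper:arxiv-quant-ph_9508027,
Literature.Computability.QuantumComplexity.FACT_mem_NP_inter_coNP_holds,
Literature.Barriers.QuantumAdvantage.SeparationPrerequisites]
Former support items, all either PROVED in Literature or vestigial, are no longer hypotheses of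
`closes` (route-repair g3,
2026-08-16; they stay listed only because drop/restate is refused under the floor):
ShorFactoringMemFBQP (= factoring_mem_FBQP, proved: factoring_mem_FBQP_holds), ShorFBQPToFACT
(proved:
FACT_mem_BQP_holds), ShorPSubsetBQP (= P_subset_BQP, proved: P_subset_BQP_holds),
ShorSearchToDecision (vestigial here;
stays the shared item stmt-QuantumAdvantage-0235 of DarkClassGroups; sole consumer of the
OneWayFunctions import), and
the legacy Assembly item (FACT_mem_BQP → FACT ∉ BPP → QuantumAdvantage, provable now: `fun h hX =>
⟨_, h, hX⟩`).

KILL CRITERIA. - `FACT ∈ BPP` proved (a bounded-error probabilistic polynomial-time algorithm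
deciding "N has a divisor
in (1,k]", equivalently polynomial-time randomized factoring) refutes `ShorThesis`; the classical
factoring line is then
dead and a discrete-log / abelian-HSP bridge would be a NEW route, not a repair.
- A refuter showing the tree's conventions misstate X (random-string `BPP = bp P` vs Gill machines,
`mem_BPP_iff_gill`;
FACT's pair encoding `encodingNatBool.pairBool`) ⇒ restate X 1:1.
- `BQP = BPP` (Literature `BQPEqBPP`) proved ⇒ the summit is refuted and the route is moot.
- Nothing else: the bridge half is a theorem already checked by the kernel.

NOT DECOMPOSED YET. Nothing. X is hypothesis-type and is neither decomposed nor staffed; the bridge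
is fully proved.

CHEAPEST FALSIFIER. A literature lookup, run first by any refuter: is there an accepted (even merely
rigorous-randomized,
heuristic-free) polynomial-time classical algorithm for integer factoring / for FACT? State of the
art says no:
heuristic GNFS at L_N[1/3, (64/9)^{1/3}], rigorous randomized L_N[1/2, 1] (Lenstra–Pomerance; tree
fact
`lenstra_pomerance`), rigorous deterministic N^{1/5+o(1)} (Harvey 2021; tree fact
`harvey_factoring_one_fifth`). The
2026-08-15 route review re-ran the lookup (arXiv/Crossref/zbMATH ≥ 2023): no classical
polynomial-time factoring claim.
Model-side falsifier (cheap `lean check`): `ShorThesis` unfolds to `FACT ∉ bp P` with the intended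
pair encoding —
grounders stamped this (route review: defs audit BQP / IsUniform / FBQP / BPP / FACT / RandAlg.pr,
no junk).

NUMBERS. - Best classical: GNFS heuristic exp((64/9)^{1/3}+o(1))(ln N)^{1/3}(ln ln N)^{2/3});
rigorous randomized
L_N[1/2,1]; rigorous deterministic N^{1/5+o(1)} (Harvey 2021).
- Shor: order finding with O(n) controlled modular multiplications, O(n^2 log n log log n) gates
with fast arithmetic
(Shor1997 §5–§7); success per run Ω(1/log log N) before repetition; certified end-to-end gate count
in Coq/SQIR
(212n²+975n+1031)m+4m+m² (PengEtAl2023, arXiv:2204.07112 p.6).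
- Tree: FACT ∈ BQP with error ≤ 1/3 on every input, exact Clifford+T {H,S,T,CNOT}, TM-uniform
(FACT_mem_BQP_holds).

DEFINITION REQUESTS. None outstanding. The 2026-08-15 want defn-FactNotInBPP (an importable
`FactNotInBPP : Prop :=
FACT ∉ BPP` to serve as `conditional_on`) is BLOCKED by rule (`literature.conjecture`: open
conjectures are not
Literature; a Theorems leaf is prover-only) and is no longer needed: the conjecture IS the route
item `ShorThesis`
(the D-0027 form "conjecture = crux item"), and a non-accepted `conditional_on` now renders as a
comment, not an error.

Novelty: Searches (2026-08-14, retriage; re-run 2026-08-15 unavailable, rc 75): `lit frontier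
QuantumAdvantage --since 2020`,
`lit bridges QuantumAdvantage --cross any`, `lit search` local + S2/zbMATH/Crossref "formally
certified Shor
factorization", `lit search --hybrid` "formalization of quantum complexity class BQP … uniform
circuit family",
`lit galaxy search --star pdf` (0 hits).
Nearest prior art found: (i) the line itself is the textbook evidence for BQP ≠ BPP — Shor1997 §1,
§5
(paper:arxiv-quant-ph_9508027 p.4: factoring and discrete log "widely believed to be hard"; §5
factoring in quantum
polynomial time), BernsteinVazirani1997 §8 (BPP ⊆ BQP), AroraBarakCC2009 §10.6 p.221, Aaronson2010
§1; as a route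
to the summit it is a CONDITIONAL BRIDGE on the standard conjecture FACT ∉ BPP and claims no new
mechanism
(expected grade: known). (ii) For the earned formal content — a machine-checked Shor theorem —
PengEtAl2023
(arXiv:2204.07112, Coq/SQIR: circuit-level certification of an end-to-end implementation over the
OpenQASM gate set,
per-run success bound and certified gate count, p.6); QPE / order-finding verifications in Prove-It
(arXiv:2304.02183 = doi:10.1103/physreva.108.052609) and Qbricks are smaller in scope.
Delta: the tree states AND NOW FULLY PROVES (standard axioms only) the COMPLEXITY-CLASS statement
`FACT ∈ BQP` /
`primeFactorsList ∈ FBQP` in a TM-uniform, exact Clifford+T circuit-family model with error ≤ 1/3 on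
every input —
class membership including uniformity, whi  [refs: 10.1103/physreva.108.052609, 2204.07112, 2304.02183, paper:arxiv-quant-ph_9508027, doi:10.1103/physreva.108.052609, Shor1997, BernsteinVazirani1997, AroraBarakCC2009, Aaronson2010, PengEtAl2023]

Barriers (technique_class: conditional-bridge, quantum-algorithm, hardness-conjecture): - technique_class: conditional-bridge, quantum-algorithm, hardness-conjecture
- Literature.Barriers.QuantumAdvantage.SeparationPrerequisites: it does not evade it; applies in
full to X — with Shor's theorem X ⟹ ∃ L ∈ BQP, L ∉ BPP ⟹ PP ⊄ BPP, P ≠ PP, P ≠ PSPACE (and X alone ⟹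
NP ⊄ BPP since FACT ∈ NP); the bet is only that X is the standard cryptographic conjecture, carried
as a hypothesis and never staffed.
- Literature.Barriers.QuantumAdvantage.Relativization: applies to any proof of X (FACT ∈ PSPACE =
P^TQBF ⊆ BPP^TQBF, so FACT ∉ BPP has no relativizing proof); not evaded, X is a hypothesis; the Shor
half FACT ∈ BQP is an inclusion true relative to every oracle, so the bridge `closes` relativizes
harmlessly.
- Literature.Barriers.QuantumAdvantage.Algebrization: same status — an algebrizing proof of X
composed with Shor's theorem would be an algebrizing proof of BQP ⊄ BPP, excluded by
`Algebrization.not_isAlgebrizingSeparation_bqp_bpp` (AaronsonWigderson2008); not evaded, X is a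
hypothesis.
- Literature.Barriers.QuantumAdvantage.NaturalProofs: would bite a circuit-lower-bound approach to X
(FACT ∉ P/poly ⟹ FACT ∉ BPP by Adleman), self-defeatingly since the hard PRGs it presupposes are
factoring-based; this route takes no such approach (that was route CircuitLB, closed superseded by
this one).
- Literature.Barriers.QuantumAdvantage.SupremacyTheoremsNonRelativizing: clause (c) ("one-way
functions ⟹ BPP ≠ BQP needs non-relativizing techniques", FortnowRogers1999JCSS Thm 4.2) co

History (route lifecycle, newest last):
- 2026-08-16T04:15:15Z · AUTO-CRUX (backfill): ShorThesis — hypotheses of the deciding theorem that nothing in the route derives are cruxes (operator:999:1085951)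
- 2026-08-16T05:19:56Z · CLOSED exhausted — exhausted (planner-rbadge-QuantumAdvantage-Shor-36c510fd-g3-0)

sub-problem: QuantumAdvantage · status: closed(exhausted) · opened planner-QuantumAdvantage-Survey-0 2026-08-13T06:04:27Z · rev 8 · ledger route-QuantumAdvantage-Shor
GENERATED by the gate from the ledger (D-0016/17). Provers cite these decls: `theorem foo : Summit.QuantumAdvantage.QuantumAdvantage.Theses.Shor.<Decl> := …` in Summits/QuantumAdvantage/QuantumAdvantage/Theorems/<Name>.lean.
-/

namespace Summit.QuantumAdvantage.QuantumAdvantage.Theses.Shor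

open scoped BigOperators Topology Manifold Classical MeasureTheory ProbabilityTheory Matrix InnerProductSpace ComplexConjugate ContinuousMap
open Filter Set Function TopologicalSpace MeasureTheory

attribute [summit_statement] _root_.QuantumAdvantage

open Literature.QuantumAdvantage

/-- item stmt-QuantumAdvantage-0231 · crux (kind.auto-crux: conjecture-grade) · rank 0 · closed · moot by None · by planner
why it might fail: X may simply be false: FACT ∈ NP ∩ coNP ∩ BQP is not NP-hard unless NP = coNP, and FACT ∈ BPP (even ∈ P) contradicts no other standard conjecture — only the absence of algorithms (GNFS L_N[1/3]) supports it; conversely X ⟹ NP ⊄ BPP (⟹ PneNP in-model), so no proof is expected.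
sources: Shor1997, AroraBarakCC2009 §10.6, paper:arxiv-quant-ph_9508027, Literature.Computability.QuantumComplexity.FACT_mem_NP_inter_coNP_holds, Literature.Barriers.QuantumAdvantage.SeparationPrerequisites
Thesis X of route Shor: the bounded-divisor factoring language FACT is not decidable in
bounded-error probabilistic polynomial time. Standard conjecture (hypothesis-type item; not expected
to be proved). [Shor1997 §1; AroraBarak2009 Ex. 2.3] -/
@[route_item "route-QuantumAdvantage-Shor", crux]
def ShorThesis : Prop :=
  Literature.Computability.QuantumComplexity.FACT ∉ Literature.Computability.Complexity.BPP

/-- item stmt-QuantumAdvantage-0233 · support · rank 2 · closed · moot by None · by planner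
Discharge the named fact: some poly-time uniform oracle-free Clifford+T family, on the binary
encoding of N, outputs with probability ≥ 2/3 a string with prefix encode(primeFactorsList N).
Requires: reversible modular exponentiation (see #5), approximate QFT over Z_{2^m} in Clifford+T
with uniformly computable rotations, order finding with success Ω(1/log log N), continued fractions,
repetition. Hardest and most informative crux. [Shor1997 §5 Thm; NielsenChuang2010 §5.3;
BernsteinVazirani1997 Def. 8] -/
@[route_item "route-QuantumAdvantage-Shor"]
def ShorFactoringMemFBQP : Prop :=
  Literature.Computability.Cryptography.factoring_mem_FBQP

/-- item stmt-QuantumAdvantage-0234 · support · rank 3 · closed · moot by None · by planner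
Closure of uniform Clifford+T families under classical polynomial-time post-processing folded into
the family: from the factor list decide ∃ d, 1<d≤k, d∣N on wire 0, keeping error ≤ 1/3
(re-run/majority if needed). Infrastructure lemma (uses P ⊆ BQP-style compilation, #5). [Shor1997
§5; Watrous2009 §III.1] -/
@[route_item "route-QuantumAdvantage-Shor"]
def ShorFBQPToFACT : Prop :=
  Literature.Computability.Cryptography.factoring_mem_FBQP → Literature.Computability.Cryptography.FACT_mem_BQP

/-- item stmt-QuantumAdvantage-0235 · support · rank 4 · closed · proved by Summit.QuantumAdvantage.QuantumAdvantage.Theorems.SearchToDecision.searchToDecision_proof @ 7ed47f74478a (prover) · by planner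
Bitwise search-to-decision: if f has exactly polynomial output length and f ∈ FBQP, each bit
language {(x,i) : (f x)_i = 1} is in BQP (read wire i of the FBQP family), hence in BPP under the
collapse; amplify each to error < 1/(3 p(|x|)) and concatenate. Makes the route robust to replacing
FACT by any FBQP function (DLOG, Pell, abelian HSP). [Aaronson2010 §1 (FBQP); BernsteinVazirani1997
§8; folklore] -/
@[route_item "route-QuantumAdvantage-Shor"]
def ShorSearchToDecision : Prop :=
  ∀ f : List Bool → List Bool, (∃ p : Polynomial ℕ, ∀ x, (f x).length = p.eval x.length) → f ∈ Literature.Computability.Cryptography.FBQP → Literature.Computability.Cryptography.BQP ⊆ Literature.Computability.Complexity.BPP → ∃ A : Literature.Computability.Complexity.RandAlg (List Bool) (List Bool), Literature.Computability.Cryptography.IsPPT A id ∧ ∀ x, 2 / 3 ≤ A.pr id x {f x}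

/-- item stmt-QuantumAdvantage-0236 · support · rank 5 · closed · moot by None · by planner
Discharge the named fact P ⊆ BQP: a poly-time TM2 decider is compiled into a poly-time uniform
family of Toffoli circuits, Toffoli exactly into Clifford+T (7 T gates), acceptance copied to wire
0. Prerequisite infrastructure for #2/#3; independently reusable (BPP ⊆ BQP follows with Hadamard
coins). [BernsteinVazirani1997 §8; NielsenChuang2010 §4.5.5, §3.2.5] -/
@[route_item "route-QuantumAdvantage-Shor"]
def ShorPSubsetBQP : Prop :=
  Literature.Computability.Cryptography.P_subset_BQP

/-- item stmt-QuantumAdvantage-0232 · assembly · rank 1 · closed · moot by None · by planner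
Assembly with the printed theorem FACT ∈ BQP (named fact
Literature.Computability.Cryptography.FACT_mem_BQP, Shor1997 §5) as hypothesis: a language in BQP
and not in BPP witnesses BQP ≠ BPP. One line. [Shor1997 §5; BernsteinVazirani1997 §8] -/
@[route_item "route-QuantumAdvantage-Shor"]
def Assembly : Prop :=
  Literature.Computability.Cryptography.FACT_mem_BQP → Literature.Computability.QuantumComplexity.FACT ∉ Literature.Computability.Complexity.BPP → QuantumAdvantage

/-! D-0027 §2.1 — DECIDING THEOREM (planner-authored via `route open/edit --closes-file`; by planner-rbadge-QuantumAdvantage-Shor-36c510fd-g3-0 2026-08-16T05:17:01Z) — ARCHIVED: route closed (exhausted) 2026-08-16T05:19:55Z; kept so importers keep building: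
its hypotheses are this route's items and its conclusion the sub-problem Statement (glue_lint), and it elaborates with this file. -/

/-- **Deciding theorem of route Shor** (D-0027 §2.1) — an explicit CONDITIONAL BRIDGE, crux-only.
From the route's single crux `ShorThesis : FACT ∉ BPP` (the factoring-hardness conjecture,
hypothesis-type, conjecture-grade) the language `FACT` witnesses the summit
`∃ L, L ∈ BQP ∧ L ∉ BPP`; Shor's theorem `FACT ∈ BQP` enters as the PROVED Literature theorem
`Literature.Computability.Cryptography.FACT_mem_BQP_holds` (ShorAssemblyLeavesProofs.lean,
axioms propext / Classical.choice / Quot.sound) inside the proof term, not as a hypothesis. -/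
@[closes "route-QuantumAdvantage-Shor"] theorem closes (hX : ShorThesis) : _root_.QuantumAdvantage :=
  ⟨Literature.Computability.QuantumComplexity.FACT,
    Literature.Computability.Cryptography.FACT_mem_BQP_holds, hX⟩

end Summit.QuantumAdvantage.QuantumAdvantage.Theses.Shor
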